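import Summits.PneNP.PneNP.Theorems.ConvexRankGatesCaptureGRankNormalForm
import Summits.PneNP.PneNP.Theorems.ConvexRankGatesCaptureGRankShadow
import Summits.PneNP.PneNP.Theorems.Capture.Negative.GateLocality
import HarnessLib

/-!
# Crux `Capture` (stmt-PneNP-2659) — GRANK door algebra IV: ONE GRANK gate ⟺ the support shadow of ONE affine
# determinant (both directions, in the tree's Valiant vocabulary `HasDetRepr`)

Route PneNP/ConvexRankGates, crux `Summit.PneNP.PneNP.Theses.ConvexRankGates.Capture` (lead c9, 2026-08-17;
`--supports stmt-PneNP-2659`). The census (STRATEGY-CENSUS S2, dead-c5 §2(b)) reads the GRANK door as "one GRANK gate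
⟺ a polynomial-size affine symbolic DETERMINANT whose monomial-support up-set is `f⁻¹(1)`". The `⇐` half is c6's
`isGRankGate_of_hasDetRepr_circuitSum` (for the canonical generating function) and, for an arbitrary polynomial, the
one-liner `isGRankGate_of_hasDetRepr_shadow` below; the `⇒` half needs the FULL-RANK NORMAL FORM of part I
(`ConvexRankGatesCaptureGRankNormalForm.lean`, generic compression over `Frac F[u,w]`) and is
`IsGRankGate.exists_hasDetRepr_shadow`: a gate of `GRANK_s` is the shadow `v ↦ [killVars v P ≠ 0]` of a polynomial `P`
with an affine determinantal representation of size `≤ s + 1` (`HasDetRepr P d`, `d ≤ s + 1`; the `+1` only serves the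
constant-false gate `θ > d`, represented by the `1 × 1` zero matrix). Registered stub `grank_shadow_normalForm`.
So, per field, `GRANK_s = {support shadows of polynomials of determinantal complexity ≤ s (+1)}` is now a two-sided kernel
statement, and every "is X one GRANK gate of polynomial dimension?" question (PQ and its relatives) is literally a question
about polynomial determinantal complexity of SOME polynomial with prescribed minimal monomial supports. No new definitions.
[folklore; Edmonds 1967 §5–§7; Bürgisser 2000 §2.5 for `dc`]
-/

namespace Summit.PneNP.PneNP.Theorems.Capture.GRankAlgebra

set_option linter.dupNamespace false -- `Summit.PneNP.PneNP.…`: summit = sub-problem (D-0017)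

open Literature.Computability.Complexity Literature.Computability.AlgebraicComplexity MvPolynomial Matrix

section Shadow

variable {F : Type*} [Field F] {n d : ℕ}

/-- The full-rank gate of square data accepts `v` iff the killed determinant of its generic symbolic matrix is
non-zero. [folklore] -/
theorem le_rank_symbolicMatrix_iff_killVars_det_ne_zero (K₀ : Matrix (Fin d) (Fin d) F)
    (K : Fin n → Matrix (Fin d) (Fin d) F) (v : Fin n → Bool) :
    d ≤ (symbolicMatrix K₀ K v).rank ↔ killVars v (symbolicPolyMatrix K₀ K).det ≠ 0 := by
  rw [le_rank_iff_det_ne_zero_of_sq, Ne, Ne, ← Matrix.submatrix_id_id (symbolicMatrix _ _ v),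
    det_submatrix_symbolicMatrix_eq_zero_iff, Matrix.submatrix_id_id]

end Shadow

/-- **`⇐`: the support shadow of ONE affine determinant is ONE GRANK gate** (of the same dimension, over the same
field): if `P = det A` with `A` a `d × d` matrix of affine linear forms and `f v = [killVars v P ≠ 0]`, then
`IsGRankGate d ⟨n, f⟩` (data = the coefficient matrices of `A`). [folklore] -/
theorem isGRankGate_of_hasDetRepr_shadow {F : Type} [Field F] {n d : ℕ} {f : (Fin n → Bool) → Bool}
    {P : MvPolynomial (Fin n) F} (hP : HasDetRepr P d) (hf : ∀ v, f v = true ↔ killVars v P ≠ 0) :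
    IsGRankGate d ⟨n, f⟩ := by
  obtain ⟨A, hA1, hAdet⟩ := hP
  refine ⟨F, inferInstance, d, d, le_rfl, fun a b => coeff 0 (A a b),
    fun i => fun a b => coeff (Finsupp.single i 1) (A a b), fun v => ?_⟩
  change f v = true ↔ _
  rw [le_rank_symbolicMatrix_iff_killVars_det_ne_zero, ValiantBarrier.symbolicPolyMatrix_coeffs_eq A hA1, hAdet, hf]

/-- **`⇒`: ONE GRANK gate is the support shadow of ONE affine determinant** of size `≤ s + 1`, over a purely
transcendental extension of the gate's field (the full-rank normal form of part I). [folklore] -/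
theorem IsGRankGate.exists_hasDetRepr_shadow {s : ℕ} {g : GateFn} (h : IsGRankGate s g) :
    ∃ (F' : Type) (_ : Field F') (d : ℕ) (P : MvPolynomial (Fin g.1) F'),
      d ≤ s + 1 ∧ HasDetRepr P d ∧ ∀ v : Fin g.1 → Bool, g.2 v = true ↔ killVars v P ≠ 0 := by
  obtain ⟨F', _, θ, hθ, K₀', K', hg⟩ := isGRankGate_fullRank h
  refine ⟨F', inferInstance, θ, (symbolicPolyMatrix K₀' K').det, hθ,
    ⟨symbolicPolyMatrix K₀' K', Negative.totalDegree_symbolicPolyMatrix_apply_le K₀' K', rfl⟩, fun v => ?_⟩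
  rw [hg v, le_rank_symbolicMatrix_iff_killVars_det_ne_zero]

/-- **The shadow is monotone DNF of the monomial supports** (for the record, tying the normal form to the library's
`killVars_ne_zero_iff`): under the conclusion of `IsGRankGate.exists_hasDetRepr_shadow`, `g` accepts `v` iff some
monomial of `P` has all its variables switched on in `v`. [folklore] -/
theorem IsGRankGate.exists_hasDetRepr_support {s : ℕ} {g : GateFn} (h : IsGRankGate s g) :
    ∃ (F' : Type) (_ : Field F') (d : ℕ) (P : MvPolynomial (Fin g.1) F'),
      d ≤ s + 1 ∧ HasDetRepr P d ∧
        ∀ v : Fin g.1 → Bool, g.2 v = true ↔ ∃ m ∈ P.support, ∀ i ∈ m.support, v i = true := by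
  obtain ⟨F', _, d, P, hd, hP, hg⟩ := IsGRankGate.exists_hasDetRepr_shadow h
  exact ⟨F', inferInstance, d, P, hd, hP, fun v => (hg v).trans (killVars_ne_zero_iff v P)⟩

/-! ## Registered form (stub `grank_shadow_normalForm` of crux stmt-PneNP-2659) -/

/-- **ONE GRANK gate ⟹ support shadow of ONE affine determinant of size `≤ s + 1`, closed statement** (the registered
stub). [folklore] -/
theorem grank_shadow_normalForm : ∀ (s : ℕ) (g : GateFn), IsGRankGate s g →
    ∃ (F' : Type) (_ : Field F') (d : ℕ) (P : MvPolynomial (Fin g.1) F'), d ≤ s + 1 ∧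
      Literature.Computability.AlgebraicComplexity.HasDetRepr P d ∧
        ∀ v : Fin g.1 → Bool, (g.2 v = true ↔ killVars v P ≠ 0) :=
  fun _ _ h => IsGRankGate.exists_hasDetRepr_shadow h

end Summit.PneNP.PneNP.Theorems.Capture.GRankAlgebra
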